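import Literature.Computability.AlgebraicComplexity.BI17DegreeExponentMonoidProofs
import Literature.Computability.AlgebraicComplexity.BI17PowerSumStabilizerProofs
import Literature.Computability.AlgebraicComplexity.BI17QuadraticPeriodProofs
import Literature.Computability.AlgebraicComplexity.BI17ChowPowerSumPolystableProofs
import HarnessLib

/-!
# Bürgisser–Ikenmeyer 2017, Prop. 3.24: degree period, minimal degree and minimal exponent of the
# power sum `X_1^D + ⋯ + X_m^D`

Topic `Literature/Computability/AlgebraicComplexity`; sibling proofs file (D-0014: theorems only, no
definitions, no named facts) of `BI17FundamentalInvariantForms.lean`, for the named fact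
`BI2017_prop_3_24` (P. Bürgisser, C. Ikenmeyer, *Fundamental invariants of orbit closures*,
J. Algebra 477 (2017), Prop. 3.24, arXiv main.tex L1315–1328): for `w = X_1^D + ⋯ + X_m^D`
(`D ≥ 2`, `m ≥ 2`),

1. `D` even: `b(w) = m`, `e(w) = m`, `e'(w) = 1` — `BI2017_prop_3_24_part1` (PROVED);
2. `D` odd: `b(w) = 2m`; if `2m ≤ binom(2D, D)` then `e(w) = 2m`, `e'(w) = 1` —
   `BI2017_prop_3_24_part2` (PROVED);
3. `D` odd and `binom(2D, D) < 2m`: `e(w) > 2m`, `e'(w) > 1` — `BI2017_prop_3_24_part3_of_cor_A_2`,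
   CONDITIONAL on the plethysm upper bound of the paper's Appendix (named fact `BI2017_cor_A_2`, "no
   `SL_m`-invariant of degree `2m` when `binom(2D,D) < 2m`", which is the printed proof; the
   positivity of some element of `E(w)` — the printed `e(w)` is the least POSITIVE element, the
   tree's `minimalDegree` an `sInf` with junk `0` — is Hilbert's nonvanishing, the tree's
   `exists_pos_mem_degreeMonoid`); and the whole named fact from that input,
   `BI2017_prop_3_24_of_cor_A_2 : BI2017_cor_A_2 → BI2017_prop_3_24`.

## Proof (the printed one, main.tex L1330–1395, over proved tree inputs)

* `a(w) = D` (`D` even) resp. `2D` (`D` odd) is Prop. 2.4(2) (`stabilizerPeriod_psum`, `D > 2`; for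
  `D = 2` the quadric `∑ X_i²` has nondegenerate Hessian, `stabilizerPeriod_eq_two_of_det_quadHessian_ne_zero`),
  so `b(w) = m a(w)/D` is `m` resp. `2m`.
* `E(w) = b(w) E'(w)` and `e(w) = b(w) e'(w)` (Lemma 3.2(3), `BI2017_lem_3_2_3_holds`; `w` is
  polystable by Cor. 2.9, `BI2017_cor_2_9_chow_powerSum_holds`), so `e'(w) = 1` as soon as
  `e(w) = b(w)`, and every positive degree in `E(w)` is a multiple of `b(w)`
  (`degreePeriod_dvd_of_mem_degreeMonoid`).
* `D` even: `e(w) = m` iff `P_{D,m}(w) ≠ 0` (Thm. 3.15 clause 3, `minimalDegree_eq_iff_aeval_cayleyP_ne_zero`)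
  and `P_{D,m}(w) = m! ≠ 0` (Thm. 3.18(2), `BI2017_thm_3_18_2_powerSum`).
* `D` odd, `2m ≤ binom(2D,D)`: the printed tableau `T` with `m` rows and `2D` columns, the letters
  `2r-1`, `2r` filling row `r` on complementary column sets `J_r`, `J_rᶜ` of size `D`, all `2m` sets
  distinct (we take the `J_r` distinct and all containing column `0`, possible iff
  `m ≤ binom(2D-1, D-1) = binom(2D,D)/2`). Its tableau function `P_T` (eq. (3.4), `tableauInvPoly`)
  is an `SL_m`-invariant form of degree `2m` on `Sym^D` (Thm. 3.11, `tableauInv_tensorMul`, here on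
  forms: `tableauInvPoly_mem_slInvariantsOfDegree`), and `P_T(w) = m!`
  (`tableauInv_powerSumArray_eq_factorial`: in a surviving summand `(σ_1,…,σ_{2D})` every letter
  carries a constant value, and the distinctness of the column sets forces `σ_1 = ⋯ = σ_{2D}` — the
  printed `(∗)`, `(∗∗)`, `(†)`; each of the `m!` constant tuples contributes `sgn(σ)^{2D} = 1`). Hence
  `2m ∈ E(w) ⊆ 2mℕ` and `e(w) = 2m`.
* `D` odd, `binom(2D,D) < 2m`: by Cor. A.2 there is no `2m`-set of `D`-subsets of `{1,…,2D}` at all,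
  so `O(Sym^D)^{SL_m}_{2m} = 0`, `2m ∉ E(w)`, and the positive elements of `E(w) ⊆ 2mℕ` are `≥ 4m`.

Honest framing (cell `val-lit`, rung V3): two thirds of a typed literature fact about power sums
proved and the whole fact reduced to one named Appendix fact of the same paper; nothing here bears on
VP versus VNP.

## References

* [BurgisserIkenmeyer2017] P. Bürgisser, C. Ikenmeyer, *Fundamental invariants of orbit closures*,
  J. Algebra 477 (2017) 390–434 = arXiv:1511.02927: Prop. 3.24 (L1315) and its proof (L1330–1395),
  §3.1 eq. (3.4) (L1007), Thm. 3.11 (L1032), Thm. 3.18 (L1195), Prop. 2.4(2) (L500), Cor. 2.9,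
  Lemma 3.2(3) (L739), App. Cor. 7.2 (L2897).

## Tree

`tableauInv`, `tableauInvPoly`, `symArrayPoly`, `map_tableauInv`, `tableauInv_tensorMul`,
`IsSLInvariantCoord`, `slInvariantsOfDegree`, `mem_slInvariantsOfDegree_iff`, `degreeMonoid`,
`minimalDegree`, `degreePeriod`, `minimalExponent`, `BI2017_thm_3_18_2_powerSum`, `BI2017_prop_3_24`,
`BI2017_cor_A_2` (`BI17FundamentalInvariantForms`); `arrOf`, `arrOf_linSubst`, `wordExp`,
`wordExp_eq_single_iff`, `wordDegIdx`, `exists_formCoeff_eq` (`Hyperdeterminant`);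
`stabilizerPeriod_psum` (`BI17PowerSumStabilizerProofs`);
`stabilizerPeriod_eq_two_of_det_quadHessian_ne_zero` (`BI17QuadraticPeriodProofs`);
`BI2017_cor_2_9_chow_powerSum_holds` (`BI17ChowPowerSumPolystableProofs`); `BI2017_lem_3_2_3_holds`,
`degreePeriod_dvd_of_mem_degreeMonoid`, `minimalDegree_eq_iff_aeval_cayleyP_ne_zero`,
`exists_pos_mem_degreeMonoid` (`BI17DegreeExponentMonoidProofs`); `coordRep_apply`, `aeval_formCoeff_coordSubst`,
`mem_orbitVanishingIdeal_iff`, `formCoeff_apply` (`OrbitCoordinateRing`); `linSubstRep_apply`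
(`LinSubst`). Mathlib: `Finset.orderEmbOfFin`, `Fintype.bijective_iff_injective_and_card`,
`Equiv.ofBijective`, `Finset.card_powersetCard`, `MvPolynomial.funext`,
`MvPolynomial.homogeneousSubmodule_fg`, `Submodule.finrank_eq_zero`.
-/

noncomputable section

open MvPolynomial
open scoped BigOperators

namespace Literature.Computability.AlgebraicComplexity

/-! ### §1 Tableau functions `P_T` as polynomial functions on `Sym^D` (any bijection `β`) -/

section TableauForms

variable {k : Type*} [Field k] {σ : Type*} [Fintype σ] [DecidableEq σ] {D d m s : ℕ}

/-- Evaluating the tableau polynomial `P_T` (BI 2017 eq. (3.4) on `Sym^D`) at a point `w` of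
`Sym^D`: the tableau function of the rescaled coordinate array. [cite: BurgisserIkenmeyer2017, eq. (3.4)] -/
theorem aeval_tableauInvPoly (β : Fin D × Fin d ≃ Fin m × Fin s) (t : Fin m → σ)
    (w : DegIdx σ D → k) :
    aeval w (tableauInvPoly (k := k) D β t) = tableauInv β fun J : Fin D → Fin m =>
      (((Finset.univ.filter fun I : Fin D → σ => wordExp I = wordExp (t ∘ J)).card : k))⁻¹ *
        w (wordDegIdx t J) := by
  rw [tableauInvPoly, show (aeval w : MvPolynomial (DegIdx σ D) k →ₐ[k] k) (tableauInv β _) =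
    (aeval w : MvPolynomial (DegIdx σ D) k →ₐ[k] k).toRingHom (tableauInv β _) from rfl,
    map_tableauInv]
  congr 1
  funext J
  change aeval w (C _ * X _) = _
  rw [map_mul, aeval_C, aeval_X, Algebra.algebraMap_self_apply]

/-- **`P_T(q)` is the tableau function of the symmetric array of the form `q`** (BI 2017 §3.1,
L993: forms as symmetric tensors `v : [m]^D → ℂ`). [cite: BurgisserIkenmeyer2017, eq. (3.4)] -/
theorem aeval_formCoeff_tableauInvPoly (β : Fin D × Fin d ≃ Fin m × Fin s) (t : Fin m → σ)
    (q : MvPolynomial σ k) :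
    aeval (formCoeff D q) (tableauInvPoly (k := k) D β t) =
      tableauInv β fun J : Fin D → Fin m => arrOf D q (t ∘ J) := by
  rw [aeval_tableauInvPoly]
  congr 1
  funext J
  rw [formCoeff_apply, arrOf, div_eq_inv_mul]
  rfl

/-- `P_T` is a form of degree `d` (the number of letters) on `Sym^D` (BI 2017 §3.1, L949: "an element
`P` in `O(Sym^D ℂ^m)^{SL_m}_d`"). [cite: BurgisserIkenmeyer2017, §3.1 (eq. (3.4))] -/
theorem isHomogeneous_tableauInvPoly (β : Fin D × Fin d ≃ Fin m × Fin s) (t : Fin m → σ) :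
    (tableauInvPoly (k := k) D β t).IsHomogeneous d := by
  classical
  unfold tableauInvPoly tableauInv
  refine IsHomogeneous.sum _ _ _ fun τ _ => ?_
  have h1 : ∀ i : Fin d, (symArrayPoly (k := k) D t fun ι => τ (β (ι, i)).2 (β (ι, i)).1).IsHomogeneous 1 :=
    fun i => by
      unfold symArrayPoly
      have h := (isHomogeneous_C (DegIdx σ D) ((((Finset.univ.filter fun I : Fin D → σ =>
        wordExp I = wordExp (t ∘ fun ι => τ (β (ι, i)).2 (β (ι, i)).1)).card : k))⁻¹)).mul
        (isHomogeneous_X k (wordDegIdx t fun ι => τ (β (ι, i)).2 (β (ι, i)).1))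
      rwa [zero_add] at h
  have h2 := IsHomogeneous.prod Finset.univ _ (fun _ => 1) fun i _ => h1 i
  rw [Finset.sum_const, Finset.card_univ, Fintype.card_fin, smul_eq_mul, mul_one] at h2
  have h3 := (isHomogeneous_C (DegIdx σ D) (∏ j, (Equiv.Perm.sign (τ j) : k))).mul h2
  rw [zero_add] at h3
  convert h3 using 2
  rw [map_prod]
  simp

/-- **BI 2017, Thm. 3.11 on forms**: `P_T(B · q) = det(B)^s P_T(q)` for every square matrix `B`
(acting by the substitution `X_i ↦ ∑_x B_{xi} X_x`) and every form `q` of degree `D`, all `m`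
variables being letters (the array of `B · q` is `(B,…,B) · A(q)`, `arrOf_linSubst`, and
`tableauInv_tensorMul`; characteristic zero for the symmetric-array normalisation).
[cite: BurgisserIkenmeyer2017, Thm. 3.11] -/
theorem aeval_formCoeff_linSubst_tableauInvPoly [CharZero k] (β : Fin D × Fin d ≃ Fin m × Fin s)
    (B : Matrix (Fin m) (Fin m) k) {q : MvPolynomial (Fin m) k} (hq : q.IsHomogeneous D) :
    aeval (formCoeff D (linSubst (Fin m) k B q)) (tableauInvPoly (k := k) D β id) =
      B.det ^ s * aeval (formCoeff D q) (tableauInvPoly (k := k) D β id) := by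
  rw [aeval_formCoeff_tableauInvPoly, aeval_formCoeff_tableauInvPoly]
  have harr : (fun J : Fin D → Fin m => arrOf D (linSubst (Fin m) k B q) (id ∘ J)) =
      fun I => ∑ J : Fin D → Fin m, (∏ r, B (I r) (J r)) * arrOf D q (id ∘ J) := by
    funext I
    exact arrOf_linSubst B hq I
  rw [harr, tableauInv_tensorMul]

/-- **`P_T ∈ O(Sym^D ℂ^m)^{SL_m}_d`** (BI 2017 §3.1, L949 / Thm. 3.11): the tableau polynomial of
any bijection `β : [D] × [d] ≃ [m] × [s]` is a homogeneous `SL_m`-invariant of degree `d`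
(invariance as a polynomial: characteristic zero, so that polynomial functions on `Sym^D` are
polynomials, `exists_formCoeff_eq`). [cite: BurgisserIkenmeyer2017, Thm. 3.11] -/
theorem tableauInvPoly_mem_slInvariantsOfDegree [CharZero k] (β : Fin D × Fin d ≃ Fin m × Fin s) :
    tableauInvPoly (k := k) D β id ∈ slInvariantsOfDegree (Fin m) k D d := by
  haveI : Infinite k := CharZero.infinite k
  rw [mem_slInvariantsOfDegree_iff]
  refine ⟨isHomogeneous_tableauInvPoly β id, fun g => ?_⟩
  apply MvPolynomial.funext
  intro c
  obtain ⟨q, hqh, hqc⟩ := exists_formCoeff_eq (k := k) c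
  rw [← hqc]
  change aeval (formCoeff D q) (coordRep (Fin m) k D (Matrix.SpecialLinearGroup.toGL g)
    (tableauInvPoly (k := k) D β id)) = aeval (formCoeff D q) (tableauInvPoly (k := k) D β id)
  rw [coordRep_apply, aeval_formCoeff_coordSubst, linSubstRep_apply,
    aeval_formCoeff_linSubst_tableauInvPoly β _ hqh]
  have hdet : (((Matrix.SpecialLinearGroup.toGL g)⁻¹ : GL (Fin m) k) : Matrix (Fin m) (Fin m) k).det = 1 := by
    rw [← map_inv, Matrix.SpecialLinearGroup.coe_GL_coe_matrix]
    exact (g⁻¹).det_coe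
  rw [hdet, one_pow, one_mul]

end TableauForms

/-! ### §2 The array of the power sum `X_1^D + ⋯ + X_m^D` -/

section PowerSumArray

variable {k : Type*} [Field k] {m D : ℕ}

/-- The coefficients of the power sum: `coeff_{x_J}(∑_a X_a^D) = [J constant]` (`D ≥ 1`).
[folklore] -/
private theorem coeff_wordExp_psum (hD : 0 < D) (J : Fin D → Fin m) :
    coeff (wordExp J) (∑ a : Fin m, (X a : MvPolynomial (Fin m) k) ^ D) =
      if ∀ j, J j = J ⟨0, hD⟩ then 1 else 0 := by
  classical
  rw [coeff_sum]
  simp only [coeff_X_pow]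
  by_cases hJ : ∀ j, J j = J ⟨0, hD⟩
  · rw [if_pos hJ, Finset.sum_eq_single (J ⟨0, hD⟩)]
    · rw [if_pos]
      exact ((wordExp_eq_single_iff (J := J)).mpr hJ).symm
    · intro a _ ha
      rw [if_neg]
      intro h
      exact ha ((wordExp_eq_single_iff (J := J)).mp h.symm ⟨0, hD⟩).symm
    · exact fun h => absurd (Finset.mem_univ _) h
  · rw [if_neg hJ]
    refine Finset.sum_eq_zero fun a _ => if_neg fun h => hJ fun j => ?_
    have h1 := (wordExp_eq_single_iff (J := J)).mp h.symm
    exact (h1 j).trans (h1 ⟨0, hD⟩).symm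

/-- The fibre of a constant word under `wordExp` is a singleton. [folklore] -/
private theorem card_filter_wordExp_const' (x : Fin m) :
    (Finset.univ.filter fun I : Fin D → Fin m => wordExp I = wordExp (fun _ : Fin D => x)).card = 1 := by
  classical
  rw [Finset.card_eq_one]
  refine ⟨fun _ => x, Finset.ext fun I => ?_⟩
  rw [Finset.mem_filter, Finset.mem_singleton,
    (wordExp_eq_single_iff (J := fun _ : Fin D => x)).mpr (fun _ => rfl), wordExp_eq_single_iff]
  exact ⟨fun h => funext h.2, fun h => ⟨Finset.mem_univ _, congrFun h⟩⟩

/-- **The symmetric array of the power sum is the diagonal `0/1` array**: `A(∑_a X_a^D)_J = 1` if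
the word `J` is constant and `0` otherwise (BI 2017, proof of Prop. 3.24: "`w(μ_1,…,μ_D) = 1` iff
`μ_1 = ⋯ = μ_D` and `0` otherwise", L1356). [cite: BurgisserIkenmeyer2017, Prop. 3.24 (proof)] -/
theorem arrOf_psum (hD : 0 < D) (J : Fin D → Fin m) :
    arrOf D (∑ a : Fin m, (X a : MvPolynomial (Fin m) k) ^ D) J =
      if ∀ j, J j = J ⟨0, hD⟩ then 1 else 0 := by
  classical
  rw [arrOf, coeff_wordExp_psum hD]
  by_cases hJ : ∀ j, J j = J ⟨0, hD⟩
  · rw [if_pos hJ, show J = fun _ => J ⟨0, hD⟩ from funext hJ]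
    -- the fibre has one element
    have h1 := card_filter_wordExp_const' (D := D) (J ⟨0, hD⟩)
    rw [Finset.card_eq_one] at h1
    obtain ⟨a, ha⟩ := h1
    have : (Finset.univ.filter fun I : Fin D → Fin m =>
        wordExp I = wordExp (fun _ : Fin D => J ⟨0, hD⟩)).card = 1 := by
      rw [Finset.card_eq_one]
      exact ⟨a, by convert ha⟩
    rw [this, Nat.cast_one, div_one]
  · rw [if_neg hJ, zero_div]

end PowerSumArray

/-! ### §3 The tableau of the printed proof for odd `D`: its value at the power sum is `m!` -/

section OddTableau

variable {k : Type*} [Field k] {m D d S : ℕ}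

/-- **The counting argument of BI 2017, proof of Prop. 3.24(2)** (`(∗)`, `(∗∗)`, `(†)`, L1348–1377),
abstractly. Let `β : [D] × [d] ≃ [m] × [S]` be a tableau such that every letter `L` lies in a single
row `row L`, and in each row `r` the cells split into the column set `J_r` and its complement so
that two cells of row `r` on the same side belong to the same letter; suppose the `J_r` are pairwise
distinct, of one common size, and all contain one common column `c₀`, and that `S` is even. Then
for the diagonal `0/1` array `v` (`v(I) = [I constant]`) the only surviving summands of `P_β(v)`
are the constant tuples `σ_1 = ⋯ = σ_S`, so `P_β(v) = m!`. [cite: BurgisserIkenmeyer2017, Prop. 3.24 (proof)] -/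
theorem tableauInv_powerSumArray_eq_factorial (hD : 0 < D) (hS : Even S)
    (β : Fin D × Fin d ≃ Fin m × Fin S) (row : Fin d → Fin m)
    (hrow : ∀ ι L, (β (ι, L)).1 = row L)
    (J : Fin m → Finset (Fin S)) (hJ : Function.Injective J) {D' : ℕ} (hJcard : ∀ r, (J r).card = D')
    (c₀ : Fin S) (hc₀ : ∀ r, c₀ ∈ J r)
    (hside : ∀ ι ι' L L', row L = row L' →
      ((β (ι, L)).2 ∈ J (row L) ↔ (β (ι', L')).2 ∈ J (row L)) → L = L') :
    tableauInv β (fun I : Fin D → Fin m => if ∀ j, I j = I ⟨0, hD⟩ then (1 : k) else 0) =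
      (m.factorial : k) := by
  classical
  unfold tableauInv
  -- the value of a letter in a surviving summand
  have key : ∀ σ : Fin S → Equiv.Perm (Fin m),
      (∏ L : Fin d, (if ∀ j : Fin D, σ (β (j, L)).2 (β (j, L)).1 = σ (β (⟨0, hD⟩, L)).2 (β (⟨0, hD⟩, L)).1
        then (1 : k) else 0)) = if ∀ c, σ c = σ c₀ then 1 else 0 := by
    intro σ
    rw [Fintype.prod_boole]
    by_cases hadm : ∀ L (j : Fin D), σ (β (j, L)).2 (β (j, L)).1 = σ (β (⟨0, hD⟩, L)).2 (β (⟨0, hD⟩, L)).1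
    · rw [if_pos hadm]
      -- the value of the letter of a cell
      have hval : ∀ r c, σ c r =
          σ (β (⟨0, hD⟩, (β.symm (r, c)).2)).2 (β (⟨0, hD⟩, (β.symm (r, c)).2)).1 := by
        intro r c
        have h := hadm (β.symm (r, c)).2 (β.symm (r, c)).1
        rw [Prod.mk.eta, Equiv.apply_symm_apply] at h
        exact h
      have hrow' : ∀ r c, row (β.symm (r, c)).2 = r := by
        intro r c
        have h := hrow (β.symm (r, c)).1 (β.symm (r, c)).2
        rw [Prod.mk.eta, Equiv.apply_symm_apply] at h
        exact h.symm
      -- cells of one row on the same side carry the same value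
      have hR : ∀ r c c', (c ∈ J r ↔ c' ∈ J r) → σ c r = σ c' r := by
        intro r c c' hcc'
        have hL : (β.symm (r, c)).2 = (β.symm (r, c')).2 := by
          refine hside (β.symm (r, c)).1 (β.symm (r, c')).1 _ _ (by rw [hrow', hrow']) ?_
          rw [Prod.mk.eta, Equiv.apply_symm_apply, Prod.mk.eta, Equiv.apply_symm_apply, hrow']
          exact hcc'
        rw [hval r c, hval r c', hL]
      -- every value is the value at the common column `c₀`
      have hconst : ∀ r c, σ c r = σ c₀ r := by
        intro r c1
        by_contra hne
        have hc1 : c1 ∉ J r := fun h => hne (hR r c1 c₀ (iff_of_true h (hc₀ r)))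
        set v := σ c₀ r with hv
        set r' := (σ c1).symm v with hr'
        have hσr' : σ c1 r' = v := by rw [hr', Equiv.apply_symm_apply]
        have hrr' : r' ≠ r := by
          intro h
          rw [h] at hσr'
          exact hne hσr'
        -- the columns where `v` sits in row `r'` avoid `J r`
        have hC' : ∀ c, σ c r' = v → c ∉ J r := by
          intro c hc hcJ
          have h1 : σ c r = v := hR r c c₀ (iff_of_true hcJ (hc₀ r))
          exact hrr' ((σ c).injective (hc.trans h1.symm))
        -- and contain the whole side of `c1` in row `r'`
        have hT : ∀ c, (c ∈ J r' ↔ c1 ∈ J r') → c ∉ J r := fun c hc =>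
          hC' c ((hR r' c c1 hc).trans hσr')
        by_cases hc1' : c1 ∈ J r'
        · exact hT c₀ (iff_of_true (hc₀ r') hc1') (hc₀ r)
        · -- `(J r')ᶜ ⊆ (J r)ᶜ`, i.e. `J r ⊆ J r'`, equal sizes: `J r = J r'`
          have hsub : J r ⊆ J r' := by
            intro c hc
            by_contra hc'
            exact hT c (iff_of_false hc' hc1') hc
          have heq : J r = J r' := Finset.eq_of_subset_of_card_le hsub (by rw [hJcard, hJcard])
          exact hrr' (hJ heq).symm
      rw [if_pos (fun c => Equiv.ext fun r => hconst r c)]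
    · rw [if_neg hadm, if_neg]
      intro hcon
      apply hadm
      intro L j
      rw [hcon (β (j, L)).2, hcon (β (⟨0, hD⟩, L)).2, hrow, hrow]
  simp_rw [key]
  -- sum over the constant tuples
  rw [show (∑ σ : Fin S → Equiv.Perm (Fin m), (∏ j, (Equiv.Perm.sign (σ j) : k)) *
      (if ∀ c, σ c = σ c₀ then (1 : k) else 0)) =
      ∑ σ : Fin S → Equiv.Perm (Fin m), if ∀ c, σ c = σ c₀ then (1 : k) else 0 from by
    refine Finset.sum_congr rfl fun σ _ => ?_
    by_cases h : ∀ c, σ c = σ c₀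
    · rw [if_pos h, mul_one]
      have hprod : (∏ j, (Equiv.Perm.sign (σ j) : k)) = (Equiv.Perm.sign (σ c₀) : k) ^ S := by
        rw [Finset.prod_congr rfl fun j _ => by rw [h j], Finset.prod_const, Finset.card_univ,
          Fintype.card_fin]
      rw [hprod]
      rcases Int.units_eq_one_or (Equiv.Perm.sign (σ c₀)) with h1 | h1
      · rw [h1]; simp
      · rw [h1]; simp [Even.neg_one_pow hS]
    · rw [if_neg h, mul_zero]]
  rw [Finset.sum_boole]
  -- the constant tuples are in bijection with `S_m`
  have hcard : (Finset.univ.filter fun σ : Fin S → Equiv.Perm (Fin m) => ∀ c, σ c = σ c₀).card =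
      (Finset.univ : Finset (Equiv.Perm (Fin m))).card := by
    refine Finset.card_bij' (fun σ _ => σ c₀) (fun π _ => fun _ => π) (fun σ _ => Finset.mem_univ _)
      (fun π _ => by simp) (fun σ hσ => ?_) (fun π _ => rfl)
    funext c
    exact ((Finset.mem_filter.mp hσ).2 c).symm
  rw [hcard, Finset.card_univ, Fintype.card_perm, Fintype.card_fin]

/-- **Half of the `D`-subsets of `[2D]` contain `0`**: if `2m ≤ binom(2D,D)` then there are `m`
pairwise distinct `D`-element subsets of `Fin (2D)` all containing `0` (complementation is a
bijection between the `D`-subsets containing `0` and those avoiding it; BI's "as long as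
`2m ≤ binom(2D,D)` we can finish this construction", L1346). [cite: BurgisserIkenmeyer2017, Prop. 3.24 (proof)] -/
theorem exists_injective_subsets_mem_zero (hD : 0 < D) (h2m : 2 * m ≤ Nat.choose (2 * D) D) :
    ∃ J : Fin m → Finset (Fin (2 * D)), Function.Injective J ∧
      ∀ r, (J r).card = D ∧ (⟨0, by omega⟩ : Fin (2 * D)) ∈ J r := by
  classical
  let z : Fin (2 * D) := ⟨0, by omega⟩
  have hPcard : ((Finset.univ : Finset (Fin (2 * D))).powersetCard D).card = Nat.choose (2 * D) D := by
    rw [Finset.card_powersetCard, Finset.card_univ, Fintype.card_fin]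
  have hAB := Finset.card_filter_add_card_filter_not
    (s := (Finset.univ : Finset (Fin (2 * D))).powersetCard D) (fun s => z ∈ s)
  -- complementation maps the `D`-subsets avoiding `0` injectively to those containing `0`
  have hBA : (((Finset.univ : Finset (Fin (2 * D))).powersetCard D).filter fun s => ¬ z ∈ s).card ≤
      (((Finset.univ : Finset (Fin (2 * D))).powersetCard D).filter fun s => z ∈ s).card := by
    refine Finset.card_le_card_of_injOn (fun s => sᶜ) (fun s hs => ?_)
      (fun s _ t _ h => compl_injective h)
    rw [Finset.mem_coe, Finset.mem_filter, Finset.mem_powersetCard] at hs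
    rw [Finset.mem_coe, Finset.mem_filter, Finset.mem_powersetCard, Finset.mem_compl]
    refine ⟨⟨Finset.subset_univ _, ?_⟩, hs.2⟩
    rw [Finset.card_compl, Fintype.card_fin, hs.1.2]
    omega
  have hmA : m ≤ (((Finset.univ : Finset (Fin (2 * D))).powersetCard D).filter fun s => z ∈ s).card := by
    omega
  -- pick `m` of them
  let f : Fin m ↪ {s // s ∈ ((Finset.univ : Finset (Fin (2 * D))).powersetCard D).filter fun s => z ∈ s} :=
    (Fin.castLEEmb hmA).trans (Finset.equivFin _).symm.toEmbedding
  refine ⟨fun r => (f r).1, fun r r' h => f.injective (Subtype.ext h), fun r => ?_⟩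
  have hmem := Finset.mem_filter.mp (f r).2
  exact ⟨(Finset.mem_powersetCard.mp hmem.1).2, hmem.2⟩

/-- **The tableau of BI 2017, proof of Prop. 3.24(2), and its value at the power sum**: for
`2m ≤ binom(2D,D)` (`D ≥ 1`) there is a tableau `β : [D] × [2m] ≃ [m] × [2D]` (row `r` filled by two
letters on complementary column sets, the `2m` sets pairwise distinct) with
`P_β(X_1^D + ⋯ + X_m^D) = m!`. [cite: BurgisserIkenmeyer2017, Prop. 3.24 (proof)] -/
theorem exists_tableau_aeval_psum_eq_factorial (hD : 0 < D) (h2m : 2 * m ≤ Nat.choose (2 * D) D) :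
    ∃ β : Fin D × Fin (2 * m) ≃ Fin m × Fin (2 * D),
      aeval (formCoeff D (∑ a : Fin m, (X a : MvPolynomial (Fin m) k) ^ D))
        (tableauInvPoly (k := k) D β id) = (m.factorial : k) := by
  classical
  obtain ⟨J, hJinj, hJ⟩ := exists_injective_subsets_mem_zero hD h2m
  -- letters `Fin (2 * m) ≃ Fin 2 × Fin m`: (side, row)
  let side : Fin (2 * m) → Fin 2 := fun L => (finProdFinEquiv.symm L).1
  let row : Fin (2 * m) → Fin m := fun L => (finProdFinEquiv.symm L).2
  -- the column set of a letter: `J r` for side `0`, its complement for side `1`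
  let T : Fin m → Fin 2 → Finset (Fin (2 * D)) := fun r b => if b = 0 then J r else (J r)ᶜ
  have hTcard : ∀ r b, (T r b).card = D := by
    intro r b
    by_cases hb : b = 0
    · simp only [T, hb, if_true, (hJ r).1]
    · simp only [T, hb, if_false]
      rw [Finset.card_compl, Fintype.card_fin, (hJ r).1]
      omega
  have hTmem : ∀ r b c, c ∈ T r b → (c ∈ J r ↔ b = 0) := by
    intro r b c hc
    by_cases hb : b = 0
    · simp only [T, hb, if_true] at hc
      exact iff_of_true hc hb
    · simp only [T, hb, if_false, Finset.mem_compl] at hc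
      exact iff_of_false hc hb
  -- the cell map
  let f : Fin D × Fin (2 * m) → Fin m × Fin (2 * D) := fun p =>
    (row p.2, (T (row p.2) (side p.2)).orderEmbOfFin (hTcard _ _) p.1)
  have hfmem : ∀ ι L, (f (ι, L)).2 ∈ T (row L) (side L) := fun ι L =>
    Finset.orderEmbOfFin_mem _ _ _
  have hfinj : Function.Injective f := by
    rintro ⟨ι, L⟩ ⟨ι', L'⟩ h
    have hr : row L = row L' := congrArg Prod.fst h
    have hc : (f (ι, L)).2 = (f (ι', L')).2 := congrArg Prod.snd h
    have hs : side L = side L' := by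
      have h1 := hTmem _ _ _ (hfmem ι L)
      have h2 := hTmem _ _ _ (hfmem ι' L')
      rw [hc, hr] at h1
      have h12 : side L = 0 ↔ side L' = 0 := h1.symm.trans h2
      rcases Fin.eq_zero_or_eq_succ (side L) with ha | ⟨a, ha⟩ <;>
        rcases Fin.eq_zero_or_eq_succ (side L') with hb | ⟨b, hb⟩
      · rw [ha, hb]
      · exact absurd (h12.mp ha) (by rw [hb]; exact Fin.succ_ne_zero _)
      · exact absurd (h12.mpr hb) (by rw [ha]; exact Fin.succ_ne_zero _)
      · rw [ha, hb, Fin.eq_zero a, Fin.eq_zero b]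
    have hL : L = L' := by
      have : finProdFinEquiv.symm L = finProdFinEquiv.symm L' := Prod.ext hs hr
      exact finProdFinEquiv.symm.injective this
    subst hL
    have hι : ι = ι' := by
      have h2 : (T (row L) (side L)).orderEmbOfFin (hTcard _ _) ι =
          (T (row L) (side L)).orderEmbOfFin (hTcard _ _) ι' := hc
      exact ((T (row L) (side L)).orderEmbOfFin (hTcard _ _)).injective h2
    rw [hι]
  have hfbij : Function.Bijective f := by
    rw [Fintype.bijective_iff_injective_and_card]
    refine ⟨hfinj, ?_⟩
    simp only [Fintype.card_prod, Fintype.card_fin]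
    ring
  let β : Fin D × Fin (2 * m) ≃ Fin m × Fin (2 * D) := Equiv.ofBijective f hfbij
  refine ⟨β, ?_⟩
  rw [aeval_formCoeff_tableauInvPoly]
  have harr : (fun I : Fin D → Fin m => arrOf D (∑ a : Fin m, (X a : MvPolynomial (Fin m) k) ^ D)
      (id ∘ I)) = fun I => if ∀ j, I j = I ⟨0, hD⟩ then (1 : k) else 0 := by
    funext I
    exact arrOf_psum hD I
  rw [harr]
  refine tableauInv_powerSumArray_eq_factorial hD ⟨D, two_mul D⟩ β row (fun ι L => rfl)
    J hJinj (fun r => (hJ r).1) ⟨0, by omega⟩ (fun r => (hJ r).2) ?_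
  -- two cells of a row on the same side belong to the same letter
  intro ι ι' L L' hLL' hiff
  have h1 := hTmem _ _ _ (hfmem ι L)
  have h2 := hTmem _ _ _ (hfmem ι' L')
  change ((f (ι, L)).2 ∈ J (row L) ↔ (f (ι', L')).2 ∈ J (row L)) at hiff
  rw [← hLL'] at h2
  have h12 : side L = 0 ↔ side L' = 0 := h1.symm.trans (hiff.trans h2)
  have hs : side L = side L' := by
    rcases Fin.eq_zero_or_eq_succ (side L) with ha | ⟨a, ha⟩ <;>
      rcases Fin.eq_zero_or_eq_succ (side L') with hb | ⟨b, hb⟩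
    · rw [ha, hb]
    · exact absurd (h12.mp ha) (by rw [hb]; exact Fin.succ_ne_zero _)
    · exact absurd (h12.mpr hb) (by rw [ha]; exact Fin.succ_ne_zero _)
    · rw [ha, hb, Fin.eq_zero a, Fin.eq_zero b]
  have : finProdFinEquiv.symm L = finProdFinEquiv.symm L' := Prod.ext hs hLL'
  exact finProdFinEquiv.symm.injective this

end OddTableau

/-! ### §4 Prop. 3.24 -/

section PropThreeTwentyFour

variable {m D : ℕ}

/-- The power sum is a form of degree `D`. [folklore] -/
private theorem psum_isHomogeneous' (m D : ℕ) :
    (∑ i : Fin m, (X i : MvPolynomial (Fin m) ℂ) ^ D).IsHomogeneous D :=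
  IsHomogeneous.sum _ _ _ fun i _ => isHomogeneous_X_pow i D

/-- The power sum is nonzero (`m, D ≥ 1`). [folklore] -/
private theorem psum_ne_zero' (hm : 0 < m) (hD : 0 < D) :
    (∑ i : Fin m, (X i : MvPolynomial (Fin m) ℂ) ^ D) ≠ 0 := by
  intro h
  have h1 := coeff_wordExp_psum (k := ℂ) (m := m) hD (fun _ => ⟨0, hm⟩)
  rw [h, coeff_zero, if_pos (fun _ => rfl)] at h1
  exact zero_ne_one h1

/-- **`b(w) = m` for `D` even** (`D ≥ 2`, `m ≥ 2`): `b(w) = m a(w) / D` with `a(w) = D`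
(Prop. 2.4(2) for `D > 2`; for `D = 2` the stabilizer period of the nondegenerate quadric
`∑ X_i²` is `2`). [cite: BurgisserIkenmeyer2017, Prop. 3.24 (1)] -/
theorem degreePeriod_psum_of_even (hD : Even D) (hD2 : 2 ≤ D) (hm : 2 ≤ m) :
    degreePeriod D (∑ i : Fin m, (X i : MvPolynomial (Fin m) ℂ) ^ D) = m := by
  rw [degreePeriod, Fintype.card_fin]
  rcases Nat.lt_or_ge 2 D with hD3 | hD3
  · rw [stabilizerPeriod_psum hD3 (by omega), if_pos hD, Nat.mul_div_cancel _ (by omega)]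
  · have hD2' : D = 2 := le_antisymm hD3 hD2
    subst hD2'
    have hdiag : ∀ i : Fin m, coeff (Finsupp.single i 2)
        (∑ a : Fin m, (X a : MvPolynomial (Fin m) ℂ) ^ 2) = 1 := by
      intro i
      rw [coeff_sum]
      simp only [coeff_X_pow]
      rw [Finset.sum_eq_single i, if_pos rfl]
      · intro a _ ha
        rw [if_neg]
        intro h
        exact ha ((Finsupp.single_left_inj (by norm_num : (2 : ℕ) ≠ 0)).mp h)
      · exact fun h => absurd (Finset.mem_univ _) h
    have hoff : ∀ {i j : Fin m}, i ≠ j → coeff (Finsupp.single i 1 + Finsupp.single j 1)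
        (∑ a : Fin m, (X a : MvPolynomial (Fin m) ℂ) ^ 2) = 0 := by
      intro i j hij
      rw [coeff_sum]
      simp only [coeff_X_pow]
      refine Finset.sum_eq_zero fun a _ => if_neg fun h => ?_
      have h1 := congrArg (fun e => e a) h
      simp only [Finsupp.single_eq_same, Finsupp.coe_add, Pi.add_apply, Finsupp.single_apply] at h1
      by_cases hia : i = a
      · by_cases hja : j = a
        · exact hij (hia.trans hja.symm)
        · rw [if_pos hia, if_neg hja] at h1
          omega
      · by_cases hja : j = a
        · rw [if_neg hia, if_pos hja] at h1
          omega
        · rw [if_neg hia, if_neg hja] at h1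
          omega
    have hsp : stabilizerPeriod (∑ i : Fin m, (X i : MvPolynomial (Fin m) ℂ) ^ 2) = 2 := by
      refine stabilizerPeriod_eq_two_of_det_quadHessian_ne_zero (by omega) (psum_isHomogeneous' m 2) ?_
      -- the Hessian matrix of `∑ X_i²` is `2 · 1`
      change Matrix.det (fun i j : Fin m => if i = j then
          2 * coeff (Finsupp.single i 2) (∑ a : Fin m, (X a : MvPolynomial (Fin m) ℂ) ^ 2)
        else coeff (Finsupp.single i 1 + Finsupp.single j 1)
          (∑ a : Fin m, (X a : MvPolynomial (Fin m) ℂ) ^ 2)) ≠ 0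
      have hM : (fun i j : Fin m => if i = j then
          2 * coeff (Finsupp.single i 2) (∑ a : Fin m, (X a : MvPolynomial (Fin m) ℂ) ^ 2)
        else coeff (Finsupp.single i 1 + Finsupp.single j 1)
          (∑ a : Fin m, (X a : MvPolynomial (Fin m) ℂ) ^ 2)) =
          Matrix.diagonal (fun _ : Fin m => (2 : ℂ)) := by
        funext i j
        by_cases hij : i = j
        · subst hij
          rw [if_pos rfl, Matrix.diagonal_apply_eq, hdiag i, mul_one]
        · rw [if_neg hij, Matrix.diagonal_apply_ne _ hij, hoff hij]
      rw [hM, Matrix.det_diagonal, Finset.prod_const, Finset.card_univ, Fintype.card_fin]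
      exact pow_ne_zero _ two_ne_zero
    rw [hsp, Nat.mul_div_cancel _ (by omega)]

/-- **`b(w) = 2m` for `D` odd** (`D ≥ 3`, `m ≥ 2`): `a(w) = 2D` (Prop. 2.4(2)).
[cite: BurgisserIkenmeyer2017, Prop. 3.24 (2)] -/
theorem degreePeriod_psum_of_odd (hD : Odd D) (hD2 : 2 ≤ D) (hm : 2 ≤ m) :
    degreePeriod D (∑ i : Fin m, (X i : MvPolynomial (Fin m) ℂ) ^ D) = 2 * m := by
  have hD3 : 2 < D := by obtain ⟨r, hr⟩ := hD; omega
  rw [degreePeriod, Fintype.card_fin, stabilizerPeriod_psum hD3 (by omega),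
    if_neg (Nat.not_even_iff_odd.mpr hD), show m * (2 * D) = 2 * m * D by ring,
    Nat.mul_div_cancel _ (by omega)]

/-- **BI 2017, Prop. 3.24 (1), PROVED**: for `D ≥ 2` even and `m ≥ 2`, the power sum
`w = X_1^D + ⋯ + X_m^D` has degree period `b(w) = m`, minimal degree `e(w) = m`, and minimal exponent
`e'(w) = 1` ("In the cases 1 and 2, we have `e'(w) = 1`"). [cite: BurgisserIkenmeyer2017, Prop. 3.24 (1)] -/
theorem BI2017_prop_3_24_part1 (hD2 : 2 ≤ D) (hm : 2 ≤ m) (hD : Even D) :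
    degreePeriod D (∑ i : Fin m, (X i : MvPolynomial (Fin m) ℂ) ^ D) = m ∧
    minimalDegree D (∑ i : Fin m, (X i : MvPolynomial (Fin m) ℂ) ^ D) = m ∧
    minimalExponent D (∑ i : Fin m, (X i : MvPolynomial (Fin m) ℂ) ^ D) = 1 := by
  have hD0 : 0 < D := by omega
  have hb := degreePeriod_psum_of_even hD hD2 hm
  have he : minimalDegree D (∑ i : Fin m, (X i : MvPolynomial (Fin m) ℂ) ^ D) = m := by
    rw [minimalDegree_eq_iff_aeval_cayleyP_ne_zero hm hD hD0 (psum_isHomogeneous' m D)]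
    have h := BI2017_thm_3_18_2_powerSum (k := ℂ) hD hD0 (Equiv.refl (Fin m))
    simp only [Equiv.refl_apply] at h
    rw [h]
    exact Nat.cast_ne_zero.mpr (Nat.factorial_ne_zero m)
  refine ⟨hb, he, ?_⟩
  have h323 := (BI2017_lem_3_2_3_holds m D _ hD2 (psum_isHomogeneous' m D)
    (psum_ne_zero' (by omega) hD0) (BI2017_cor_2_9_chow_powerSum_holds.2 m D (by omega))).2
  rw [he, hb] at h323
  exact Nat.eq_of_mul_eq_mul_left (by omega : 0 < m) (h323.symm.trans (mul_one m).symm)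

/-- **`2m ∈ E(w)` for `D ≥ 1` and `2m ≤ binom(2D,D)`**: the tableau function of the printed tableau
is an `SL_m`-invariant of degree `2m` with `P_T(w) = m! ≠ 0`. [cite: BurgisserIkenmeyer2017, Prop. 3.24 (proof)] -/
theorem two_mul_mem_degreeMonoid_psum (hD0 : 0 < D) (h2m : 2 * m ≤ Nat.choose (2 * D) D) :
    2 * m ∈ degreeMonoid D (∑ i : Fin m, (X i : MvPolynomial (Fin m) ℂ) ^ D) := by
  obtain ⟨β, hβ⟩ := exists_tableau_aeval_psum_eq_factorial (k := ℂ) (m := m) hD0 h2m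
  obtain ⟨hPh, hPi⟩ := (mem_slInvariantsOfDegree_iff D (2 * m) _).mp
    (tableauInvPoly_mem_slInvariantsOfDegree (k := ℂ) β)
  refine ⟨_, hPh, hPi, ?_⟩
  rw [mem_orbitVanishingIdeal_iff, not_forall]
  refine ⟨1, ?_⟩
  rw [map_one, Module.End.one_apply, hβ]
  exact Nat.cast_ne_zero.mpr (Nat.factorial_ne_zero m)

/-- **BI 2017, Prop. 3.24 (2), PROVED**: for `D ≥ 2` odd and `m ≥ 2`, the power sum has degree
period `b(w) = 2m`; if moreover `2m ≤ binom(2D,D)` then `e(w) = 2m` and `e'(w) = 1`.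
[cite: BurgisserIkenmeyer2017, Prop. 3.24 (2)] -/
theorem BI2017_prop_3_24_part2 (hD2 : 2 ≤ D) (hm : 2 ≤ m) (hD : Odd D) :
    degreePeriod D (∑ i : Fin m, (X i : MvPolynomial (Fin m) ℂ) ^ D) = 2 * m ∧
    (2 * m ≤ Nat.choose (2 * D) D →
      minimalDegree D (∑ i : Fin m, (X i : MvPolynomial (Fin m) ℂ) ^ D) = 2 * m ∧
      minimalExponent D (∑ i : Fin m, (X i : MvPolynomial (Fin m) ℂ) ^ D) = 1) := by
  have hD0 : 0 < D := by omega
  have hb := degreePeriod_psum_of_odd hD hD2 hm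
  refine ⟨hb, fun h2m => ?_⟩
  have hw := psum_isHomogeneous' m D
  have hw0 := psum_ne_zero' (m := m) (by omega) hD0
  have hpoly := BI2017_cor_2_9_chow_powerSum_holds.2 m D (by omega)
  have hmem := two_mul_mem_degreeMonoid_psum (m := m) hD0 h2m
  have he : minimalDegree D (∑ i : Fin m, (X i : MvPolynomial (Fin m) ℂ) ^ D) = 2 * m := by
    have hS : 2 * m ∈ {d | d ∈ degreeMonoid D (∑ i : Fin m, (X i : MvPolynomial (Fin m) ℂ) ^ D) ∧
        0 < d} := ⟨hmem, by omega⟩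
    rw [minimalDegree]
    refine le_antisymm (Nat.sInf_le hS) (le_csInf ⟨2 * m, hS⟩ fun d hd => ?_)
    have hdvd := degreePeriod_dvd_of_mem_degreeMonoid hD2 hw hw0 hpoly hd.1
    rw [hb] at hdvd
    exact Nat.le_of_dvd hd.2 hdvd
  refine ⟨he, ?_⟩
  have h323 := (BI2017_lem_3_2_3_holds m D _ hD2 hw hw0 hpoly).2
  rw [he, hb] at h323
  exact Nat.eq_of_mul_eq_mul_left (by omega : 0 < 2 * m) (h323.symm.trans (mul_one _).symm)

/-- **No `SL_m`-invariants of degree `2m` when `binom(2D,D) < 2m`, from App. Cor. 7.2** (the printed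
proof of Prop. 3.24 (3): "There is no nonzero `SL_m`-invariant in degree `2m` if
`binom(2D,D) < 2m` … there are only `binom(2D,D)` many cardinality `D` subsets of `{1,…,2D}`",
L1390–1394). Conditional on the named fact `BI2017_cor_A_2`. [cite: BurgisserIkenmeyer2017, Prop. 3.24 (3) (proof)] -/
theorem slInvariantsOfDegree_two_mul_eq_bot_of_cor_A_2 (hA : BI2017_cor_A_2) (hD : Odd D)
    (hm : 1 ≤ m) (hlt : Nat.choose (2 * D) D < 2 * m) :
    slInvariantsOfDegree (Fin m) ℂ D (2 * m) = ⊥ := by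
  classical
  have h := hA D (2 * m) m hD hm ⟨2 * D, by ring⟩
  have hn : D * (2 * m) / m = 2 * D := by
    rw [show D * (2 * m) = 2 * D * m by ring, Nat.mul_div_cancel _ (by omega)]
  have hcard : ((Finset.univ : Finset (Finset (Finset (Fin (D * (2 * m) / m))))).filter fun S =>
      S.card = 2 * m ∧ (∀ s ∈ S, s.card = D) ∧
        ∀ i : Fin (D * (2 * m) / m), (S.filter fun s => i ∈ s).card = m).card = 0 := by
    rw [Finset.card_eq_zero, Finset.filter_eq_empty_iff]
    intro S _ hS
    have hsub : S ⊆ (Finset.univ : Finset (Fin (D * (2 * m) / m))).powersetCard D :=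
      fun s hs => Finset.mem_powersetCard.mpr ⟨Finset.subset_univ _, hS.2.1 s hs⟩
    have hle := Finset.card_le_card hsub
    rw [hS.1, Finset.card_powersetCard, Finset.card_univ, Fintype.card_fin, hn] at hle
    omega
  rw [hcard, Nat.le_zero] at h
  haveI : Module.Finite ℂ (homogeneousSubmodule (DegIdx (Fin m) D) ℂ (2 * m)) :=
    Module.Finite.iff_fg.mpr (homogeneousSubmodule_fg _ _ _)
  haveI : Module.Finite ℂ (slInvariantsOfDegree (Fin m) ℂ D (2 * m)) :=
    Submodule.finiteDimensional_of_le
      (show slInvariantsOfDegree (Fin m) ℂ D (2 * m) ≤ homogeneousSubmodule (DegIdx (Fin m) D) ℂ (2 * m)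
        from inf_le_left)
  exact Submodule.finrank_eq_zero.mp h

/-- **BI 2017, Prop. 3.24 (3), from App. Cor. 7.2**: for `D ≥ 2` odd, `m ≥ 2` and
`binom(2D,D) < 2m`, IF the Appendix bound `BI2017_cor_A_2` holds then `e(w) > 2m` and `e'(w) > 1`
(`2m ∉ E(w) ⊆ 2mℕ`; `E(w)` has a positive element by Hilbert's nonvanishing for the polystable `w`,
`exists_pos_mem_degreeMonoid`; `e = b e'` with `b = 2m`). [cite: BurgisserIkenmeyer2017, Prop. 3.24 (3)] -/
theorem BI2017_prop_3_24_part3_of_cor_A_2 (hA : BI2017_cor_A_2) (hD2 : 2 ≤ D) (hm : 2 ≤ m)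
    (hD : Odd D) (hlt : Nat.choose (2 * D) D < 2 * m) :
    2 * m < minimalDegree D (∑ i : Fin m, (X i : MvPolynomial (Fin m) ℂ) ^ D) ∧
    1 < minimalExponent D (∑ i : Fin m, (X i : MvPolynomial (Fin m) ℂ) ^ D) := by
  have hD0 : 0 < D := by omega
  have hw := psum_isHomogeneous' m D
  have hw0 := psum_ne_zero' (m := m) (by omega) hD0
  have hpoly := BI2017_cor_2_9_chow_powerSum_holds.2 m D (by omega)
  have hpos := exists_pos_mem_degreeMonoid (by omega : 0 < m) hw hw0 hpoly
  have hb := degreePeriod_psum_of_odd hD hD2 hm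
  have hbot := slInvariantsOfDegree_two_mul_eq_bot_of_cor_A_2 hA hD (by omega) hlt
  -- `2m ∉ E(w)`
  have hnot : 2 * m ∉ degreeMonoid D (∑ i : Fin m, (X i : MvPolynomial (Fin m) ℂ) ^ D) := by
    rintro ⟨F, hFh, hFi, hFI⟩
    have hmem : F ∈ slInvariantsOfDegree (Fin m) ℂ D (2 * m) :=
      (mem_slInvariantsOfDegree_iff D (2 * m) F).mpr ⟨hFh, hFi⟩
    rw [hbot, Submodule.mem_bot] at hmem
    exact hFI (hmem ▸ Ideal.zero_mem _)
  -- the least positive element of `E(w)` is a multiple of `2m` other than `2m`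
  have hne : ({d | d ∈ degreeMonoid D (∑ i : Fin m, (X i : MvPolynomial (Fin m) ℂ) ^ D) ∧ 0 < d} :
      Set ℕ).Nonempty := by
    obtain ⟨d, hd, hd0⟩ := hpos
    exact ⟨d, hd, hd0⟩
  have hmin := Nat.sInf_mem hne
  have he : 2 * m < minimalDegree D (∑ i : Fin m, (X i : MvPolynomial (Fin m) ℂ) ^ D) := by
    rw [minimalDegree]
    have hdvd := degreePeriod_dvd_of_mem_degreeMonoid hD2 hw hw0 hpoly hmin.1
    rw [hb] at hdvd
    obtain ⟨e, he⟩ := hdvd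
    have he0 : e ≠ 0 := by
      rintro rfl
      exact absurd hmin.2 (by rw [he, mul_zero]; exact lt_irrefl 0)
    have he1 : e ≠ 1 := by
      rintro rfl
      rw [mul_one] at he
      exact hnot (he ▸ hmin.1)
    rw [he]
    have : 2 ≤ e := by omega
    nlinarith
  refine ⟨he, ?_⟩
  have h323 := (BI2017_lem_3_2_3_holds m D _ hD2 hw hw0 hpoly).2
  rw [hb] at h323
  rw [h323] at he
  by_contra hle
  rw [not_lt] at hle
  have : 2 * m * minimalExponent D (∑ i : Fin m, (X i : MvPolynomial (Fin m) ℂ) ^ D) ≤ 2 * m * 1 :=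
    Nat.mul_le_mul_left _ hle
  omega

/-- **BI 2017, Prop. 3.24 — the named fact `BI2017_prop_3_24` REDUCED to App. Cor. 7.2.** Parts
(1) and (2) are unconditional (`BI2017_prop_3_24_part1`, `BI2017_prop_3_24_part2`); part (3) uses
the plethysm upper bound `BI2017_cor_A_2` (the named fact of the paper's Appendix, which is its
printed proof). [cite: BurgisserIkenmeyer2017, Prop. 3.24] -/
theorem BI2017_prop_3_24_of_cor_A_2 (hA : BI2017_cor_A_2) : BI2017_prop_3_24 := by
  intro D m hD2 hm
  exact ⟨fun hD => BI2017_prop_3_24_part1 hD2 hm hD, fun hD => BI2017_prop_3_24_part2 hD2 hm hD,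
    fun hD hlt => BI2017_prop_3_24_part3_of_cor_A_2 hA hD2 hm hD hlt⟩

end PropThreeTwentyFour

end Literature.Computability.AlgebraicComplexity

end
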